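import Summits.QuantumFields.BalabanUV.Beta.FP.TowerDoorDefectFamilyLoc
import Literature.MathematicalPhysics.QuantumFieldTheory.Balaban1983to89.Beta.DecimatedMomentSummable

/-!
# `BalabanUV.Beta.FP.TowerDoorPairingDecay` — road «FP», binder row D1: **THE DOOR FUNCTIONAL ON THE RECORD GAUGE FUNCTION DECAYS IN THE WINDOW — v10's LETTER `hτda`, GENERIC HALF**
# (an2 J-NOTE-21 §4 (iii): «`hτa`: `|τ j κ y (λℤ_(μ,0))| ≤ Σ_u |ω_κ(u − L•y)|·|λℤ_(μ,0)(u)| ≤ ‖ω‖₁-weighted e^{−δ′|L•y|}` (PART 59 + `ω`'s localisation at `L•y`) ⇒ `AbsMoment₂`».)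

WHAT ([folklore] `ℓ¹` bookkeeping; generic lattice functions `ω λ : Site (3+1) → ℝ`, no record object; imports (R1) `TowerDoorDefectFamilyLoc` (for `l1_natCast_zsmul`) + lit; no `def`,
no `def … : Prop`, nothing cited, 0 sorry, default heartbeats).
§1 **`abs_tsum_mul_le_of_loc`** — THE PAIRING OF TWO EXPONENTIALLY LOCALISED LATTICE FUNCTIONS IS EXPONENTIALLY SMALL IN THE DISTANCE OF THEIR CENTRES: for `|ω u| ≤ B·e^{−a|u − p|₁}`,
`|λ u| ≤ K·e^{−b|q − u|₁}` and `0 < m ≤ a, b`: `|Σ'_u ω u·λ u| ≤ B·K·Zl(m/2)·e^{−(m/2)|p − q|₁}` (termwise triangle inequality through `u`; lit `tsum_of_norm_bounded` against the shifted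
exponential majorant, lit `tsum_exp_shift'`); `summable_abs_mul_of_loc` (the pairing converges absolutely).
§2 **`decay510_pairing_of_loc`** — with the window weight centred at the origin (`|ω u| ≤ B·e^{−a|u|₁}`) and the gauge function at the blocked origin in PART 59's orientation
(`|λ u| ≤ K·e^{−b|L•0 − u|₁}`), the translated pairing `y ↦ c·Σ'_u ω (u − L•y)·λ u` is `Decay510 … (|c|·B·K·Zl(m/2)) (m/2)` (`|L•y|₁ = L|y|₁ ≥ |y|₁` for `L ≥ 1`);
§3 **`absMoment₂_pairing_of_loc`** — hence `AbsMoment₂ (fun y => c·Σ'_u ω (u − L•y)·λ u)` (lit `absMoment₂_of_decay510`) — the shape of v10 `FP/StepRecursionFeedNestedNamedI`'s letter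
`hτda : AbsMoment₂ (fun y => τd j κ y (lamd j μ 0))` at door index `n+1` once the row's instance unfolds `τd (n+1) κ y (lamd (n+1) μ 0) = κτ n·Σ'_u ω n κ (u − Lc^(n+2)•y)·lamRec (sn n) n μ 0 u`
(road XREAD-1 §7) and feeds an2 PART 67's bound on the weight `ω` (window `(0, κ)`) and PART 59 `exists_abs_lamZ_record_le_exp` at the source `z = 0`.
WHAT THIS IS NOT: not `hτda` AT THE RECORD (the row's `exact`), not `hτd`, not `hX`, not (T2); nothing of Bałaban's asserted, valued or discharged; 0 estimates beyond bookkeeping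
constants; 0∕4 row-D1 binders (hW, hR, D1Tel, D1Rep); v10 NOT filed; NOT (C1), NOT (T-ID), NOT D1, NEVER «G-an2-4 closed», NOT BetaPertH, NOT continuum, NOT Clay.
HONEST DEPENDENCY (page 1, mandatory): continuum YM on T⁴ ⇐ BetaPertH ∧ nine spine estimates (0/9 proved); BetaPertH ⇐ (D1) ∧ (D4) ∧ CAP+tail;
G-an2-4 gates asym, D1 and NE2/3/4.  HONEST FRAMING (cell contract, verbatim): «discharging `BetaPertH` makes Bałaban's UV stability UNCONDITIONAL —
a real constructive-QFT result; it is NOT the continuum limit and NOT the Clay problem.»  ABSOLUTE RULE (cell charter, verbatim): «No internally-minted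
statement may enter as a cited fact. Every hypothesis is either kernel-proved in this package or a verbatim quotation of a PUBLISHED theorem with page
reference. The manuscript(s) under audit are NOT citable for their own disputed steps — they are the thing under adjudication; programme-internal
(2001/route/tribunal) claims are never citable.»  Road «FP» OWNER, b2b-balaban-beta-d1-p3 gen 55, 2026-08-29.  No existing file touched.
-/

noncomputable section

open scoped BigOperators
open Literature.MathematicalPhysics.QuantumFieldTheory
open Literature.MathematicalPhysics.QuantumFieldTheory.Balaban1983to89
open Literature.MathematicalPhysics.QuantumFieldTheory.Balaban1983to89.Beta
open Literature.MathematicalPhysics.QuantumFieldTheory.Balaban1983to89.B12Sec2to5 (l1 l1_nonneg Decay510)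
open ExpKernelCalculus (Site Zl Zl_nonneg l1_sub_triangle l1_sub_symm summable_exp_shift' tsum_exp_shift')
open DecimatedMomentSummable (AbsMoment₂ absMoment₂_of_decay510)
open Summit.QuantumFields.BalabanUV.Beta.FP.TowerDoorDefectFamilyLoc (l1_natCast_zsmul)

namespace Summit.QuantumFields.BalabanUV.Beta.FP.TowerDoorPairingDecay

/-! ## §1 The pairing of two exponentially localised lattice functions -/

/-- [folklore] termwise: `|ω u·λ u| ≤ (B·K·e^{−(m/2)|p − q|₁})·e^{−(m/2)|u − p|₁}` (rates weakened to `m`, triangle inequality `|p − q|₁ ≤ |p − u|₁ + |u − q|₁`). -/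
theorem abs_mul_le_of_loc {ω lam : Site (3 + 1) → ℝ} {B K a b m : ℝ} {p q : Site (3 + 1)} (hB : 0 ≤ B) (hK : 0 ≤ K)
    (hω : ∀ u, |ω u| ≤ B * Real.exp (-a * l1 (u - p))) (hlam : ∀ u, |lam u| ≤ K * Real.exp (-b * l1 (q - u)))
    (hm : 0 ≤ m) (hma : m ≤ a) (hmb : m ≤ b) (u : Site (3 + 1)) :
    |ω u * lam u| ≤ (B * K * Real.exp (-(m / 2) * l1 (p - q))) * Real.exp (-(m / 2) * l1 (u - p)) := by
  rw [abs_mul]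
  have n1 := l1_nonneg (u - p)
  have n2 := l1_nonneg (q - u)
  have h1 : |ω u| ≤ B * Real.exp (-m * l1 (u - p)) :=
    (hω u).trans (mul_le_mul_of_nonneg_left (Real.exp_le_exp.mpr (by nlinarith)) hB)
  have h2 : |lam u| ≤ K * Real.exp (-m * l1 (q - u)) :=
    (hlam u).trans (mul_le_mul_of_nonneg_left (Real.exp_le_exp.mpr (by nlinarith)) hK)
  have t : l1 (p - q) ≤ l1 (u - p) + l1 (q - u) := by
    have h := l1_sub_triangle p u q; rw [l1_sub_symm p u, l1_sub_symm u q] at h; exact h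
  have hexp : Real.exp (-m * l1 (u - p)) * Real.exp (-m * l1 (q - u))
      ≤ Real.exp (-(m / 2) * l1 (p - q)) * Real.exp (-(m / 2) * l1 (u - p)) := by
    rw [← Real.exp_add, ← Real.exp_add, Real.exp_le_exp]
    nlinarith [mul_nonneg hm n1, mul_nonneg hm n2, mul_nonneg hm (show 0 ≤ l1 (u - p) + l1 (q - u) - l1 (p - q) by linarith)]
  calc |ω u| * |lam u| ≤ (B * Real.exp (-m * l1 (u - p))) * (K * Real.exp (-m * l1 (q - u))) :=
        mul_le_mul h1 h2 (abs_nonneg _) ((abs_nonneg _).trans h1)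
    _ = B * K * (Real.exp (-m * l1 (u - p)) * Real.exp (-m * l1 (q - u))) := by ring
    _ ≤ B * K * (Real.exp (-(m / 2) * l1 (p - q)) * Real.exp (-(m / 2) * l1 (u - p))) :=
        mul_le_mul_of_nonneg_left hexp (mul_nonneg hB hK)
    _ = _ := by ring

/-- [folklore] **`summable_abs_mul_of_loc`** — the pairing of two exponentially localised lattice functions converges absolutely. -/
theorem summable_abs_mul_of_loc {ω lam : Site (3 + 1) → ℝ} {B K a b m : ℝ} {p q : Site (3 + 1)} (hB : 0 ≤ B) (hK : 0 ≤ K)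
    (hω : ∀ u, |ω u| ≤ B * Real.exp (-a * l1 (u - p))) (hlam : ∀ u, |lam u| ≤ K * Real.exp (-b * l1 (q - u)))
    (hm : 0 < m) (hma : m ≤ a) (hmb : m ≤ b) : Summable fun u => |ω u * lam u| := by
  refine Summable.of_nonneg_of_le (fun u => abs_nonneg _) (fun u => abs_mul_le_of_loc hB hK hω hlam hm.le hma hmb u) ?_
  exact (summable_exp_shift' (half_pos hm) p).mul_left _

/-- [folklore] **`abs_tsum_mul_le_of_loc` — THE PAIRING OF TWO EXPONENTIALLY LOCALISED LATTICE FUNCTIONS IS EXPONENTIALLY SMALL IN THE DISTANCE OF THEIR CENTRES**: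
for `|ω u| ≤ B·e^{−a|u − p|₁}`, `|λ u| ≤ K·e^{−b|q − u|₁}` and `0 < m ≤ a, b`: `|Σ'_u ω u·λ u| ≤ B·K·Zl(m/2)·e^{−(m/2)|p − q|₁}`. -/
theorem abs_tsum_mul_le_of_loc {ω lam : Site (3 + 1) → ℝ} {B K a b m : ℝ} {p q : Site (3 + 1)} (hB : 0 ≤ B) (hK : 0 ≤ K)
    (hω : ∀ u, |ω u| ≤ B * Real.exp (-a * l1 (u - p))) (hlam : ∀ u, |lam u| ≤ K * Real.exp (-b * l1 (q - u)))
    (hm : 0 < m) (hma : m ≤ a) (hmb : m ≤ b) :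
    |∑' u, ω u * lam u| ≤ B * K * Zl (3 + 1) (m / 2) * Real.exp (-(m / 2) * l1 (p - q)) := by
  have hs := (summable_exp_shift' (half_pos hm) p).mul_left (B * K * Real.exp (-(m / 2) * l1 (p - q)))
  have hb : ‖∑' u, ω u * lam u‖ ≤ ∑' u : Site (3 + 1), B * K * Real.exp (-(m / 2) * l1 (p - q)) * Real.exp (-(m / 2) * l1 (u - p)) :=
    tsum_of_norm_bounded hs.hasSum (fun u => by rw [Real.norm_eq_abs]; exact abs_mul_le_of_loc hB hK hω hlam hm.le hma hmb u)
  rw [Real.norm_eq_abs] at hb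
  refine hb.trans (le_of_eq ?_)
  rw [tsum_mul_left, tsum_exp_shift']
  ring

/-! ## §2 The translated pairing decays in the window -/

/-- [folklore] **`decay510_pairing_of_loc` — THE TRANSLATED PAIRING DECAYS IN THE WINDOW**: for a weight centred at the origin, `|ω u| ≤ B·e^{−a|u|₁}`, a gauge function at the blocked origin
in PART 59's orientation, `|λ u| ≤ K·e^{−b|L•0 − u|₁}`, `0 < m ≤ a, b` and `L ≥ 1`: `Decay510 (fun y => c·Σ'_u ω (u − L•y)·λ u) (|c|·B·K·Zl(m/2)) (m/2)`. -/
theorem decay510_pairing_of_loc (L : ℕ) [NeZero L] (c : ℝ) {ω lam : Site (3 + 1) → ℝ} {B K a b m : ℝ} (hB : 0 ≤ B) (hK : 0 ≤ K)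
    (hω : ∀ u, |ω u| ≤ B * Real.exp (-a * l1 u)) (hlam : ∀ u, |lam u| ≤ K * Real.exp (-b * l1 (((L : ℕ) : ℤ) • (0 : Site (3 + 1)) - u)))
    (hm : 0 < m) (hma : m ≤ a) (hmb : m ≤ b) :
    Decay510 (fun y : Site (3 + 1) => c * ∑' u, ω (u - ((L : ℕ) : ℤ) • y) * lam u) (|c| * (B * K * Zl (3 + 1) (m / 2))) (m / 2) := by
  intro y
  have hω' : ∀ u, |ω (u - ((L : ℕ) : ℤ) • y)| ≤ B * Real.exp (-a * l1 (u - ((L : ℕ) : ℤ) • y)) := fun u => hω _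
  have hlam' : ∀ u, |lam u| ≤ K * Real.exp (-b * l1 ((0 : Site (3 + 1)) - u)) := fun u => by
    have h := hlam u; rw [smul_zero] at h; exact h
  have h := abs_tsum_mul_le_of_loc (ω := fun u => ω (u - ((L : ℕ) : ℤ) • y)) hB hK hω' hlam' hm hma hmb
  rw [abs_mul, mul_assoc (|c|)]
  refine mul_le_mul_of_nonneg_left (h.trans ?_) (abs_nonneg c)
  refine mul_le_mul_of_nonneg_left (Real.exp_le_exp.mpr ?_) (by have := Zl_nonneg (D := 3 + 1) (half_pos hm); positivity)
  rw [sub_zero, l1_natCast_zsmul]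
  have hL1 : (1 : ℝ) ≤ (L : ℝ) := by exact_mod_cast Nat.one_le_iff_ne_zero.mpr (NeZero.ne L)
  nlinarith [l1_nonneg y, mul_nonneg hm.le (l1_nonneg y), mul_le_mul_of_nonneg_right hL1 (l1_nonneg y)]

/-! ## §3 `AbsMoment₂` — v10's letter `hτda` at door index `n+1`, generic half -/

/-- [folklore] **`absMoment₂_pairing_of_loc` — v10 `FP/StepRecursionFeedNestedNamedI`'s LETTER `hτda` AT DOOR INDEX `n+1`, GENERIC HALF**: for a weight centred at the origin
(`|ω u| ≤ B·e^{−a|u|₁}`, `0 < a`) and a gauge function at the blocked origin in PART 59's orientation (`|λ u| ≤ K·e^{−b|L•0 − u|₁}`, `0 < b`):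
`AbsMoment₂ (fun y => c·Σ'_u ω (u − L•y)·λ u)` (lit `absMoment₂_of_decay510` on §2 at `m := min a b`). -/
theorem absMoment₂_pairing_of_loc (L : ℕ) [NeZero L] (c : ℝ) {ω lam : Site (3 + 1) → ℝ} {B K a b : ℝ} (hB : 0 ≤ B) (hK : 0 ≤ K) (ha : 0 < a) (hb : 0 < b)
    (hω : ∀ u, |ω u| ≤ B * Real.exp (-a * l1 u)) (hlam : ∀ u, |lam u| ≤ K * Real.exp (-b * l1 (((L : ℕ) : ℤ) • (0 : Site (3 + 1)) - u))) :
    AbsMoment₂ (fun y : Site (3 + 1) => c * ∑' u, ω (u - ((L : ℕ) : ℤ) • y) * lam u) :=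
  absMoment₂_of_decay510 (half_pos (lt_min ha hb))
    (decay510_pairing_of_loc L c hB hK hω hlam (lt_min ha hb) (min_le_left _ _) (min_le_right _ _))

end Summit.QuantumFields.BalabanUV.Beta.FP.TowerDoorPairingDecay

end
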